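import Literature.NumberTheory.EllipticCurves.YanZhu2026.AnticyclotomicBDPHeegnerEquivalence
import HarnessLib

/-!
# Yan–Zhu 2026 (J. Algebra 693 = arXiv:2412.20078v4), §5.2: Theorem 5.9 (= arXiv v2 Thm. 4.14) —
# the PINNED, CLASS-NUMBER-FREE reading: `𝒳_{𝓕_Gr}(E/K_∞⁻)` is `Λ_K⁻`-torsion and, for every
# nontrivial multiplicative `S ⊂ Λ_K⁻`, the `S`-localised Heegner point divisibility IMPLIES the
# `S`-localised BDP divisibility (and the reversed BDP divisibility implies the reversed Heegner point
# divisibility) — the two halves of the printed equivalence that print gives in the tree's currency at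
# EVERY class number

Source: Xiaojun Yan, Xiuwu Zhu, *Main conjectures for non-CM elliptic curves at good ordinary primes*,
J. Algebra **693** (2026) 372–402, doi:10.1016/j.jalgebra.2026.01.016 = arXiv:2412.20078 (v4 TeX
`main.tex`: §5.2 setting l.1189–1190, `S_ord`/`κ` l.1199–1207, **Theorem 5.9** l.1283–1293, its use
l.1295–1308; = v2 §4.5 p0011 L49–L52 / L59 / Thm. 4.14 L96–L105 [corpus:paper:arxiv-2412.20078]).
Bib key `YanZhu2024MainConjNonCM`. The companions `AnticyclotomicMainTheorems.lean` (vocabulary,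
`Thm57Hypotheses`, Thm. 5.7) and `AnticyclotomicBDPHeegnerEquivalence.lean` (Thm. 5.9 as a double
equivalence, unpinned and PINNED, both under `Thm57Hypotheses` and hence under the tree vocabulary's
EXTRA `p ∤ h_K`) fix the currency; this file adds ONE named fact in exactly that currency — the same
theorem read WITHOUT the class-number hypothesis and, correspondingly, only in the two directions print
delivers in the tree's currency at every class number — and restates nothing. Cell `pub/bsd-print-x9`
(D-0154 rows 9/10), referee ruling REF-104 ADDENDUM "(T2)-general" (2026-08-28: pin mandatory;
directions (2) ⟹ (1) and (1′) ⟹ (2′) only; page check recorded; proof-level flag token), seat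
`bsd-line-x10b-p3` (the consumer: the B-side cruxes `TwoSidedLink[AnyClassNumber][X10b]Pinned[OfPrint]`
of routes PrintX9 / PrintX10b / TorsionLayerDescent, whose kernel re-runs
`Summits/BirchSwinnertonDyer/BirchSwinnertonDyer/Theorems/PrintX10bTwoSidedLinkAnyClassNumberX10bOfPrintFactsPinned[Link].lean`
carry exactly this statement at `S = {1}` as their explicit hypothesis `h59gp`).

## The printed statement and its setting (verbatim)

Setting (§5.2, v4 l.1189–1190 = v2 p0011 L49–L52): "Let `E/ℚ` be an elliptic curve of conductor `N`,
`p > 2` a prime such that `E` has good ordinary reduction at `p`, `K` an imaginary quadratic field such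
that `p = 𝔭𝔭̄` split in `K` and `(E, K)` satisfies the Heegner hypothesis. Assume that residue
representation `ρ̄_E|_{G_K} : G_K → Aut(E[p])` is irreducible." (`𝓛_p^BDP(E/K)` under §3.5's standing
"`D_K` is odd and not equal to `−3`"; "Fix a modular parametrization `π : X₀(N) → E`. In [PR],
Perrin-Riou constructed an element `κ ∈ S_ord(E/K_∞⁻)` via the Kummer images of Heegner points on
`X₀(N)`, which is `Λ_K⁻`-non-torsion by Cornut-Vatsal [CV]", v2 p0011 L59.)

"Similarly to [BCK], we have the following theorem. **Theorem 5.9** (v2: 4.14). `𝒳_{𝓕_Gr}(E/K_∞⁻)`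
is `Λ_K`-torsion and for every nontrivial multiplicative set `S ⊂ Λ_K⁻`, the following are
equivalent • `S⁻¹Char_{Λ_K}(𝒳_{𝓕_Gr}(E/K_∞⁻))Λ_K^{ur,−} ⊃ (𝓛_p^BDP(E/K))`. •
`S⁻¹Char_{Λ_K⁻}(𝒳_ord(E/K_∞⁻)_tor) ⊃ S⁻¹Char_{Λ_K⁻}(S_ord(E/K_∞⁻)/Λ_K⁻·κ)²`. The same result holds for
the opposite divisibilities." ([BCK] = Burungale–Castella–Kim, Algebra Number Theory 15 (2021),
Thm. 5.2 = arXiv:1908.09512 Thm. 4.1.)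

NO CLASS-NUMBER HYPOTHESIS IS PRINTED, neither here nor in the source of the proof: BCK21 §1.1
(arXiv:1908.09512 p0003 L5–L7, verbatim) "Let `E/ℚ` be an elliptic curve of conductor `N` and let `K`
be an imaginary quadratic field of discriminant `D_K` prime to `N`. Let `p > 3` be a prime of good
ordinary reduction for `E` and such that `p ∤ D_K`". The tree's two typings of Thm. 5.9 carry
`p ∤ h_K` only as the field `Thm57Hypotheses.not_dvd_classNumber` — the Heegner-family vocabulary's
EXTRA standing hypothesis, "special case" (`-- TODO(general form)` in `AnticyclotomicMainTheorems.lean`).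

## Why only two of the four halves (tree currency vs print currency when `p ∣ h_K`)

The tree types side (2) with `heegnerCharIdeal D F = char_Λ(D.S ⧸ heegnerModule D F)`
(`HeegnerModuleIndex.lean`): Howard's MODULE `ℋ_∞(F) = lim← ℋ̄_k`, `ℋ̄_k` generated over `ℤ_p[Gal(K_k/K)]`
by the Kummer images of ALL the family's norm points `y_K, z_0, …, z_k` (`z_j` a norm to `K_j` of a
Heegner point of conductor `p^{j+1}`, typed over the compositum `K_j·K[p^{j+1}]` — `IsHeegnerNormPoint`
— so at every class number). Print's side (2) is about `Char(S_ord/Λ_K⁻·κ)` for the ONE class `κ`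
of Perrin-Riou, which is, layer by layer, a `ℤ_p`-combination of the Kummer images of `z_k, z_{k−1}`
(the `p`-ordinary regularisation of the trace relations), hence `Λκ ⊆ ℋ_∞(F)`; as `S/ℋ_∞(F)` is then a
quotient of `S/Λκ`, `Char(S/Λκ) ⊆ I(ℋ_∞(F))` ALWAYS. Consequently, in the one-element form
`S = {sⁿ}` used by the typings: tree-(2)ₛ ⟹ print-(2)ₛ ⟹[print] print-(1)ₛ = tree-(1)ₛ, and
print-(1′)ₛ = tree-(1′)ₛ ⟹[print] print-(2′)ₛ ⟹ tree-(2′)ₛ hold at every class number, while the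
other two halves, (1) ⟹ (2) and (2′) ⟹ (1′), need `ℋ_∞(F) = Λκ` — Howard, Compos. Math. 140 (2004),
Thm. 3.3.7, printed under `p ∤ h_K` — and are NOT asserted here (they remain available, under
`Thm57Hypotheses`, from `thm59_XGr_isTorsion_bdp_iff_heegnerPoint_localised_pinned`). This is the cell
referee's direction-safety condition (REF-104 ADDENDUM (b)).

## The pin (mandatory, as in the pinned typing)

`¬ (p : ℤ) ∣ F.Dt.c` — print's "`c_π` is a `p`-adic unit": BCK21 Remark 1.2 (arXiv:1908.09512v2 TeX
l.192–195) "the second equality of characteristic ideals in (ii) includes the factor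
`c_π · (#𝒪_K^×)/2` … `𝒪_K^× = {±1}` by our hypothesis (disc), and `c_π` is a `p`-adic unit by [Mazur]
and our hypothesis that `p ∤ N`", App. A (l.1116–1120); CGLS22 §1 Conj. 1 (arXiv:2008.02571 p. 3)
displays the factor `(c_E² u_K²)⁻¹`; `u_K = 1` from `D_K` odd `≠ −3`. Without the pin the `∀ F` layout
is `μ`-blind (cell finding PIN-1; module docstring of `AnticyclotomicBDPHeegnerEquivalence.lean`).

## Proof-level page check (REF-104 ADDENDUM (c); numbers, not adjectives) and the flag

The printed proof is "Similarly to [BCK]" / "Arguing as in [BCK, Theorem 5.2]" (v2 p0011 L96; v4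
l.1283). In BCK21 the `Λ`-adic Heegner class and its Kolyvagin system are "constructed as in
[howard-kolyvagin]", nonvanishing from Cornut–Vatsal (arXiv:1908.09512 p0007 L60–L82; BCK's Thm. 3.1
restates Howard without a class-number clause), and the equivalence Thm. 4.1 (= journal 5.2; proof
p0009) rests on the exact identity (A4) `ord_{𝔓'}(𝓛_𝔭^BDP) = length(coker loc_𝔭) + length(𝒮/Λκ_∞)`
from the explicit reciprocity law Thm. 4.4, via the appendix of Castella, J. Lond. Math. Soc. 96
(2017) — NOT held by the cell (acquisition request acq-13689 open). The class-number-free mechanism for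
that law is in print in Castella–Hsieh, Math. Ann. 370 (2018), Thm. 5.7 (arXiv:1505.08165 p0019
L9–L30, over `Λ(Γ̃)`, `Γ̃ = Gal(K[p^∞]/K)`; p0010 L73). The ONLY `p ∤ h_K` in the chain's sources is
Howard 2004: Thm. B (arXiv:1202.6340 p0003 L109, "assume also that `p` does not divide the class
number of `K`") and §3.3 (p0018 L56–L60, "`K_∞/K` is linearly disjoint from the Hilbert class field
`K[1]`, and `K_k` is the maximal `p`-power subextension of `K[p^{k+1}]/K`") — bookkeeping for the
layers of the family, which the tree's `HeegnerFamily` does not need. VERDICT OF THE CHECK: at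
`p ∤ h_K` the fact below is two halves of the accepted pinned typing
(`thm59_anyClassNumber_halves_of_thm59_pinned`, proved); at `p ∣ h_K` it is PRINT-BY-OMISSION of a
class-number hypothesis that neither the theorem's paper nor the paper of its proof prints, while one
input construction of the cited proof chain (Howard 2004) prints it — recorded as the cell's
proof-level documentation flag `YZ59-anyhK@BCK52-How04` (priced in the census; lifted if acq-13689 /
the Castella–Hsieh road is confirmed class-number-free at the page), exactly as the flag
`YZ26@3-BF-ERL-Ohta` documents the `p = 3` inputs of Thm. 5.7. Status: REFEREED and published;
statement-only; nothing is asserted (D-0014): one named fact, no `_holds`.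

## Contents
* `thm59_XGr_isTorsion_bdp_of_heegnerPoint_localised_pinned_anyClassNumber` — the named fact (this
  file is statement-only). Proved unfoldings live in the companion
  `AnticyclotomicBDPOfHeegnerPointAnyClassNumberProofs.lean`: `thm59_anyClassNumber_halves_of_thm59_pinned`
  (under `p ∤ h_K` the fact is implied by the accepted pinned typing — its only new content is the
  range `p ∣ h_K`), `isTorsion_XAc_of_thm59_pinned_anyClassNumber`, and the `S = {1}` unfolding
  `bdp_mem_of_heegner_le_of_thm59_pinned_anyClassNumber` (= the consumers' hypothesis `h59gp`).

## References
* X. Yan, X. Zhu, J. Algebra 693 (2026) 372–402 = arXiv:2412.20078v4, Thm. 5.9 l.1283–1293, §5.2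
  l.1187–1312 (= v2 Thm. 4.14, §4.5 p0011).
* A. Burungale, F. Castella, C.-H. Kim, Algebra Number Theory 15 (2021) 1627–1653 = arXiv:1908.09512,
  §1.1, Remark 1.2, §3, Thm. 4.4, Thm. 5.2 (= arXiv Thm. 4.1) and App. A.
* F. Castella, M.-L. Hsieh, Math. Ann. 370 (2018) 567–628 = arXiv:1505.08165, Thm. 5.7.
* F. Castella, J. Lond. Math. Soc. 96 (2017) 156–180 (appendix; not held, acq-13689).
* B. Howard, Compos. Math. 140 (2004) 1439–1472 = arXiv:1202.6340, Thm. B, §3.3, Thm. 3.3.7.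
* B. Perrin-Riou, Bull. Soc. Math. France 115 (1987) 399–456, §1 Conj. B, §3.4.
* F. Castella, G. Grossi, J. Lee, C. Skinner, Invent. Math. 227 (2022) = arXiv:2008.02571, §1 Conj. 1.
* Tree: `YanZhu2026/AnticyclotomicMainTheorems.lean`, `YanZhu2026/AnticyclotomicBDPHeegnerEquivalence.lean`,
  `HeegnerModuleIndex.lean` (`HeegnerFamily`, `heegnerModule`, `heegnerCharIdeal`, `IsHeegnerNormPoint`).
-/


noncomputable section

open scoped Classical

open PowerSeries WeierstrassCurve NumberField IsDedekindDomain Field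
  Literature.NumberTheory.EllipticCurves Literature.NumberTheory.EllipticCurves.ModularForms
  Literature.NumberTheory.QuadraticFields Literature.NumberTheory.EllipticCurves.Rank1Residual
  Literature.NumberTheory.EllipticCurves.Castella2018


namespace Literature.NumberTheory.EllipticCurves.YanZhu2026

/-! ## The CLASS-NUMBER-FREE pinned typing: the two print-safe one-way implications
## (2026-08-28, cell `pub/bsd-print-x9`, REF-104 ADDENDUM "(T2)-general"; seat `bsd-line-x10b-p3`) -/

/-- **Yan–Zhu, J. Algebra 693 (2026), Theorem 5.9 (arXiv v4 l.1283–1293; = v2 Thm. 4.14), PINNED to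
print's normalisation of `κ` AND READ AT EVERY CLASS NUMBER — the torsion of `𝒳_{𝓕_Gr}(E/K_∞⁻)` and,
for every nontrivial multiplicative `S ⊂ Λ_K⁻`, the two ONE-WAY implications (2) ⟹ (1) and
(1′) ⟹ (2′) of the printed equivalence.** Verbatim (§5.2; "Fix a modular parametrization
`π : X₀(N) → E` … `κ ∈ S_ord(E/K_∞⁻)` via the Kummer images of Heegner points on `X₀(N)`, which is
`Λ_K⁻`-non-torsion by Cornut-Vatsal [CV]"; "Similarly to [BCK], we have the following theorem"):
"The module `𝒳_{𝓕_Gr}(E/K_∞⁻)` is `Λ_K⁻`-torsion, and for every nontrivial multiplicative set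
`S ⊂ Λ_K⁻`, the following statements are equivalent: (1)
`S⁻¹Char_{Λ_K⁻}(𝒳_{𝓕_Gr}(E/K_∞⁻))Λ_K^{ur,−} ⊃ (𝓛_p^BDP(E/K))`. (2)
`S⁻¹Char_{Λ_K⁻}(𝒳_{𝓕_ord}(E/K_∞⁻)_tor) ⊃ S⁻¹Char_{Λ_K⁻}(S_ord(E/K_∞⁻)/Λ_K⁻·κ)²`. The equivalence also
holds with the divisibility reversed", under §5.2's setting (arXiv v4 l.1189–1190 = v2 p0011 L49–L52,
verbatim: "Let `E/ℚ` be an elliptic curve of conductor `N`, `p > 2` a prime such that `E` has good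
ordinary reduction at `p`, `K` an imaginary quadratic field such that `p = 𝔭𝔭̄` split in `K` and
`(E, K)` satisfies the Heegner hypothesis. Assume that residue representation `ρ̄_E|_{G_K} : G_K →
Aut(E[p])` is irreducible.") and §3.5 (`D_K` odd, `≠ −3`). NO CLASS-NUMBER HYPOTHESIS IS PRINTED:
neither Yan–Zhu's §5.2 setting nor the setting of the source of the proof — Burungale–Castella–Kim,
ANT 15 (2021), §1.1 (arXiv:1908.09512 p0003 L5–L7, verbatim: "Let `E/ℚ` be an elliptic curve of
conductor `N` and let `K` be an imaginary quadratic field of discriminant `D_K` prime to `N`. Let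
`p > 3` be a prime of good ordinary reduction for `E` and such that `p ∤ D_K`") — restricts `h_K`; the
two typings above carry `p ∤ h_K` only through `Thm57Hypotheses.not_dvd_classNumber`, the tree
Heegner-family vocabulary's EXTRA standing hypothesis ("special case", `-- TODO(general form)` in the
companion `AnticyclotomicMainTheorems.lean`). THIS fact is the general form IN THE CLASS NUMBER, with
`Thm57Hypotheses` spelled out field by field WITHOUT `not_dvd_classNumber` (binder order of the
consumer `X11b.YZComposite` re-runs: `IsNewformOf W f`, `N = N_E`, `3 ≤ p`, `GoodOrd`, (irr_K),
`K` imaginary quadratic, (Heeg) for `N`, (spl), `D_K` odd, `D_K ≠ −3`, `κ` anticyclotomic,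
`[Fact (κ.IsTopGenerator γ)]`), and it is deliberately WEAKER IN DIRECTION: of the four halves of the
printed double equivalence it asserts only (2)ₛ ⟹ (1)ₛ and (1′)ₛ ⟹ (2′)ₛ (one-element form
`S = {sⁿ}`, `s ∈ Λ ∖ {0}`, exactly as in the two typings above).
WHY ONLY THESE TWO HALVES (tree currency vs print currency at `p ∣ h_K`; cell referee ruling
REF-104 ADDENDUM (b), 2026-08-28): the tree types side (2) with `heegnerCharIdeal D F =
char_Λ(D.S ⧸ heegnerModule D F)`, Howard's MODULE `ℋ_∞(F) = lim ℋ_k` generated by the Kummer images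
of ALL the family's norm points (`HeegnerModuleIndex.lean`), whereas print's (2) is about
`Char(S_ord/Λ_K⁻·κ)` for the ONE class `κ`; Perrin-Riou's `κ` is, layer by layer, a
`ℤ_p`-combination of the Kummer images of the norm points `z_k, z_{k−1}` (the `p`-ordinary
regularisation), so `Λκ ⊆ ℋ_∞(F)` and hence `Char(S/Λκ) ⊆ I(ℋ_∞(F))` ALWAYS (`S/ℋ_∞` is a quotient of
`S/Λκ`); therefore tree-(2)ₛ ⟹ print-(2)ₛ ⟹ print-(1)ₛ = tree-(1)ₛ and print-(1′)ₛ = tree-(1′)ₛ ⟹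
print-(2′)ₛ ⟹ tree-(2′)ₛ are implied by print at every class number, while the halves (1) ⟹ (2) and
(2′) ⟹ (1′) need `ℋ_∞(F) = Λκ` (Howard 2004 Thm. 3.3.7, printed under `p ∤ h_K`) and are NOT asserted
here (they remain available under `Thm57Hypotheses` from
`thm59_XGr_isTorsion_bdp_iff_heegnerPoint_localised_pinned`).
THE PIN (as in the pinned typing above, mandatory: REF-104 (a)): `¬ (p : ℤ) ∣ F.Dt.c` — print's "`c_π`
is a `p`-adic unit" (BCK21 Remark 1.2, arXiv:1908.09512v2 TeX l.192–195; App. A l.1116–1120; CGLS22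
Conj. 1's factor `(c_E² u_K²)⁻¹`; `u_K = 1` from `D_K` odd `≠ −3`).
PROOF-LEVEL PAGE CHECK (REF-104 ADDENDUM (c), recorded as asked; numbers, not adjectives): the printed
proof is "Arguing as in [BCK, Theorem 5.2]" (YZ v4 l.1283; v2 p0011 L96). In BCK21 the Λ-adic
Heegner class and its Kolyvagin system are "constructed as in [howard-kolyvagin]" with nonvanishing
from Cornut–Vatsal (arXiv:1908.09512 p0007 L82), BCK's Thm. 3.1 restating Howard WITHOUT a
class-number clause, and the equivalence (Thm. 4.1 = journal Thm. 5.2, proof p0009) rests on the exact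
identity (A4) `ord_{𝔓'}(𝓛_𝔭^BDP) = length(coker loc_𝔭) + length(𝒮/Λκ_∞)` from the explicit
reciprocity law (Thm. 4.4) via the appendix of Castella, JLMS 96 (2017) (NOT held by the cell:
acq-13689 open); the class-number-free mechanism for that law exists in print in Castella–Hsieh, Math.
Ann. 370 (2018), Thm. 5.7 (arXiv:1505.08165 p0019 L9–L30, over `Λ(Γ̃)`, `Γ̃ = Gal(K[p^∞]/K)`, p0010
L73). The ONLY `p ∤ h_K` in the chain's sources is Howard, Compos. Math. 140 (2004): Thm. B
(arXiv:1202.6340 p0003 L109 "assume also that `p` does not divide the class number of `K`") and §3.3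
(p0018 L56–L60: "`K_∞/K` is linearly disjoint from the Hilbert class field `K[1]`, and `K_k` is the
maximal `p`-power subextension of `K[p^{k+1}]/K`") — bookkeeping for the layers of the family, which
the tree's `HeegnerFamily` does not need (`z_j = Norm_{K_j K[p^{j+1}]/K_j} P[p^{j+1}]` is typed over
the compositum, `IsHeegnerNormPoint`, at every `h_K`). VERDICT OF THE CHECK: at `p ∤ h_K` this fact
is two halves of the accepted pinned typing (`thm59_anyClassNumber_halves_of_thm59_pinned`, proved
in the companion `…Proofs.lean`); at `p ∣ h_K` it is PRINT-BY-OMISSION of a class-number hypothesis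
that neither the theorem's paper nor the paper of its proof prints, while one input of the proof chain
(Howard 2004) prints it — recorded as the cell's proof-level documentation flag
`YZ59-anyhK@BCK52-How04` (priced in the census, lifted if acq-13689 / the Castella–Hsieh road is
confirmed class-number-free at the page), exactly as the flag `YZ26@3-BF-ERL-Ohta` documents the
`p = 3` inputs of Thm. 5.7. Statement-only; refereed and published; nothing is asserted (D-0014).
Transcription: as the pinned typing (module docstring), with `Thm57Hypotheses` replaced by the
explicit binders listed above; conclusion: a frame `(Ω_K, Ω_p, L)` of `𝓛_p^BDP(E/K)`
(`IsBDPLFunction`) with `𝒳 = AcSelmer.XAc (W.baseChange K) p κ vbar ∅ γ` torsion and, for all data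
`D`, `F`, `X`, `j` WITH `¬ (p : ℤ) ∣ F.Dt.c`, for every `s ∈ Λ ∖ {0}`:
[`∃ n, sⁿ·(heegnerCharIdeal D F)² ⊆ char(X.X_tors)`] → [`∃ n, j(s)ⁿ·L ∈ char(𝒳)·R₀⟦T⟧`] and
[`∃ n, j(s)ⁿ·char(𝒳)·R₀⟦T⟧ ⊆ (L)`] → [`∃ n, sⁿ·char(X.X_tors) ⊆ (heegnerCharIdeal D F)²`].
[cite: YanZhu2024MainConjNonCM, Thm. 5.9 (§5.2, arXiv:2412.20078v4 TeX l.1283–1293) with setting l.1189–1190 (= v2 §4.5 p0011 L49–L52, no class-number hypothesis), `κ` l.1205–1207, §3.5 l.882; = arXiv v2 Thm. 4.14 (p0011 L96–L105)]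
[cite: BurungaleCastellaKim2021, §1.1 setting (arXiv:1908.09512 p0003 L5–L7: `p > 3`, `(D_K, N) = 1`, `p ∤ D_K`, no class-number hypothesis); Remark 1.2 (v2 TeX l.192–195); §3 (p0007 L60–L82); Thm. 5.2 = arXiv Thm. 4.1 with its proof eq. (A4) (p0009; v2 TeX l.1044–1097)]
[cite: Howard2004HeegnerKolyvagin, Thm. B (arXiv:1202.6340 p0003 L109) and §3.3 (p0018 L56–L60): the standing `p ∤ h_K` of the tree vocabulary; Thm. 3.3.7 (`𝐇 = Λκ`, the two halves NOT asserted here)]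
[cite: CastellaHsieh2018, Thm. 5.7 (arXiv:1505.08165 p0019 L9–L30; `Γ̃ = Gal(K[p^∞]/K)`, p0010 L73)]
[cite: CastellaGrossiLeeSkinner2022, §1 Conj. 1 (arXiv:2008.02571 p. 3: the factor `(c_E² u_K²)⁻¹`)]
[cite: PerrinRiou1987BSMF, §3.4 (`ℋ_∞ = lim ℋ_n`, `κ`), §1 Conj. B] -/
def thm59_XGr_isTorsion_bdp_of_heegnerPoint_localised_pinned_anyClassNumber : Prop :=
  ∀ {p : ℕ} [Fact p.Prime] (ι' : PadicAlgCl p ≃+* ℂ) (W : WeierstrassCurve ℚ) [W.IsElliptic]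
    [W.IsGloballyMinimal] (K : Type) [Field K] [NumberField K] (v vbar : HeightOneSpectrum (𝓞 K))
    (κ : ZpExtension K p) (γ : absoluteGaloisGroup K) [Fact (κ.IsTopGenerator γ)] {N : ℕ} [NeZero N]
    {f : CuspForm (CongruenceSubgroup.Gamma0 N) 2} (jbar : AlgebraicClosure K →+* ℂ)
    (_ : IsNewformOf W f),
    N = W.conductorNorm ℤ → 3 ≤ p → GoodOrd W p → (W.baseChange K).HasIrreducibleModPGaloisRep p →
    IsImaginaryQuadratic K → SatisfiesHeegnerHypothesis N K →
      ((Ideal.span {(p : ℤ)}).primesOver (𝓞 K)).ncard = 2 →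
      Odd (discr K) → discr K ≠ -3 → κ.IsAnticyclotomic →
    (∀ (w : InfinitePlace K) (k : 𝓞 K), k ∈ v.asIdeal ↔ ‖ι'.symm (w.embedding (k : K))‖ < 1) →
      ((p : ℕ) : 𝓞 K) ∈ vbar.asIdeal → vbar ≠ v →
    ∃ (ΩK : ℂ) (Ωp : (unrIntegers p)ˣ) (L : UnrSeries p),
      ΩK ≠ 0 ∧ IsBDPLFunction ι' v κ γ f ΩK ((Ωp : unrIntegers p) : ℂ_[p]) L ∧
      Module.IsTorsion (IwasawaAlgebra p) (AcSelmer.XAc (W.baseChange K) p κ vbar ∅ γ) ∧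
      ∀ (D : (W.baseChange K).LambdaAdicSelmerData κ γ) (F : HeegnerFamily N W K κ jbar)
        (X : (W.baseChange K).SelmerDualData κ γ) (j : ℤ_[p] →+* unrIntegers p),
        ¬ (p : ℤ) ∣ F.Dt.c →
        (∀ x : ℤ_[p], ((j x : unrIntegers p) : ℂ_[p]) = algebraMap ℚ_[p] ℂ_[p] (x : ℚ_[p])) →
        ∀ s : IwasawaAlgebra p, s ≠ 0 →
          ((∃ n : ℕ, ∀ g ∈ heegnerCharIdeal D F ^ 2,
              s ^ n * g ∈ Module.charIdeal (IwasawaAlgebra p)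
                (Submodule.torsion (IwasawaAlgebra p) X.X)) →
            (∃ n : ℕ, (PowerSeries.map j s) ^ n * L ∈
              (AcSelmer.XAc.charIdeal (W.baseChange K) p κ vbar ∅ γ).map (PowerSeries.map j))) ∧
          ((∃ n : ℕ, ∀ G ∈ (AcSelmer.XAc.charIdeal (W.baseChange K) p κ vbar ∅ γ).map
              (PowerSeries.map j), (PowerSeries.map j s) ^ n * G ∈ Ideal.span {L}) →
            (∃ n : ℕ, ∀ g ∈ Module.charIdeal (IwasawaAlgebra p)
              (Submodule.torsion (IwasawaAlgebra p) X.X), s ^ n * g ∈ heegnerCharIdeal D F ^ 2))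


end Literature.NumberTheory.EllipticCurves.YanZhu2026

end
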